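import Literature.IUT.HodgeArakelov.CohomologySystemOfContH1
import Literature.IUT.HodgeArakelov.MonoThetaCyclotomesBridgeEtTh
import Literature.AnabelianGeometry.EtaleTheta.ThetaEnvOfSetting
import Literature.AnabelianGeometry.EtaleTheta.RigidOfSetting
import HarnessLib

/-!
# [IUTchII] Prop 1.4 over the genuine [EtTh] model: the output `(Π_Ÿ(Π), (l·Δ_Θ)(Π), θ(Π))` instantiated

Discharge companion (abc-iut cell, node **IUTchII:Prop1.4**, D-0067 cone of [IUTchIII] Cor 3.12) of the
landed interface `EtaleThetaData S P` (`MonoThetaFromGroups.lean`, abc-iut-L6-t1). S. Mochizuki,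
*Inter-universal Teichmüller theory II*, kurims manuscript (Dec. 2020), §1, Prop. 1.4 p. 27: "there exist
functorial group-theoretic algorithms `Π ↦ Π_Ÿ(Π); Π ↦ (l·Δ_Θ)(Π); Π ↦ θ(Π) ⊆ H¹(Π_Ÿ(Π), (l·Δ_Θ)(Π))` for
constructing from `Π` [a topological group isomorphic to `Π^tp_{X̲̲_k}`] the open subgroup `Π_Ÿ(Π) ⊆ Π`
corresponding to the tempered covering `Ÿ̲` [cf. the discussion preceding [EtTh], Definition 2.7] and a
certain subquotient `(l·Δ_Θ)(Π)` … as well as … the set `θ(Π)` of `μ_l`-multiples … of the reciprocal of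
the `(l·ℤ × μ_2)`-orbit `η̈^{Θ,l·ℤ×μ_2}` of an `l`-th root of the étale theta function of standard type …
[constant multiple rigidity, [EtTh] Cor. 2.19, (iii)]" [claim: Mochizuki2012, status: disputed]
(IUTchII §1 Prop 1.4, kurims p.27). The landed typing records the OUTPUT as a structure and notes: "the
existence content is the owners' construction of the output below for the genuine reference group …;
functoriality = transport of the output structure along `≃ₜ*`". This file supplies BOTH.

* **Functoriality** (Part A, over the interface only): `CohomologySystem.comap`, `EtaleThetaData.comap` —
  transport of the Prop. 1.4 output along an isomorphism of topological groups `P' ≃ₜ* P`; and the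
  observation that the interface FORCES its reference subgroup to be characteristic
  (`EtaleThetaData.map_piYddRef_eq`): the [EtTh] Cor. 2.18 (i) input below is necessary, not only
  sufficient.
* **The construction for the genuine group** (Part B): `Π := Π^tp_{X̲̲}` of an [EtTh] §1 theta setting
  `D` with a choice `C : E.DoubleUnderline l` of `X̲̲` (abc-iut-L2-t8) — the [IUTchII] §1 setting being
  `ThetaSetting.ofDoubleUnderline` (MERGE-MAP B8 part 3): `Π_Ÿ(Π) := Π^tp_Ÿ ∩ Π^tp_{X̲̲}` (= L2's
  `thetaEnvData.PiYdd`), `(l·Δ_Θ)(Π) :=` the inverse image of `l·Δ_Θ` modulo `Ker(Π^tp_{X̲̲} → (Π^tp_X)^Θ)`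
  (= L2's `rigidData.lDeltaTheta ⧸ thetaKer`), the cohomology system := abc-iut-L6-t1's
  `cohomologySystemOfContH1` on genuine continuous `H¹(Π^tp_{Ÿ̲̲}|_J, l·Δ_Θ)` (MERGE-MAP §2 row
  `MonoThetaFromGroups.lean :226`), the orbit := the `Π^tp_{X̲̲} (↠ Π^tp_{X̲̲}/Π^tp_{Ÿ̲̲} ≅ (l·ℤ) × μ_2)`-orbit
  of the class `η̲̈^Θ ∈ H¹(Π^tp_{Ÿ̲̲}, l·Δ_Θ)` of the `l·Δ_Θ`-valued lift of `η̈^Θ|_{Ÿ̲̲}` supplied by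
  `DoubleUnderline.eta_res` ([EtTh] p. 41 "the class `η̈^Θ` determines a class `η̲̈^Θ ∈ H¹(Π^tp_Ÿ̲̲, l·Δ_Θ)`";
  the lift, hence the orbit, is determined up to a root of unity of order `l`, [EtTh] Cor. 2.8 (i) —
  `θ(Π)`, the `μ_l`-saturation, is insensitive to that choice), and `θ(Π)` by the landed `theta_eq`.
  The ONE non-definitional clause, "corresponding to the tempered covering `Ÿ̲`" (`PiYdd_corresponds`:
  `Π_Ÿ` is carried to the reference by EVERY isomorphism `Π ≅ Π^tp_{X̲̲_k}`), is the statement that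
  `Π^tp_Ÿ̲̲ ⊆ Π^tp_X̲̲` is stable under every automorphism of the topological group `Π^tp_X̲̲` — the `Π^tp_Ÿ`
  clause of [EtTh] Cor. 2.18 (i) (L2's named fact `RigidData.Cor218_i`, FACT-policy): it enters BY NAME as
  the hypothesis `hchar` (no new `Prop` is introduced).

"Of standard type" ([EtTh] Def. 1.9 (ii) / 2.7) is a normalisation of the INPUT class `E.etaDd` (abc-iut-L2-t1
`MuTwoSetting.IsOfStandardType`), exactly as in L2-t8's `thetaEnvData`; it is not re-encoded here.
HONEST FRAMING: bookkeeping over Mathlib + landed files; [EtTh] is refereed, [IUTchII] is typed record-only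
under the claim key `Mochizuki2012` (D-0012, disputed); nothing here takes a side on [IUTchIII] Cor. 3.12;
typed ≠ proved. [cite: MochizukiEtTh2009, Def 2.7 p.41]
-/

noncomputable section

namespace Literature.IUT.HodgeArakelov

open Literature.AnabelianGeometry.EtaleTheta

universe u

/-! ## Part A. Functoriality of the Prop. 1.4 output: transport along `P' ≃ₜ* P` -/

namespace CohomologySystem

variable {P P' : TopGroup.{u}}

/-- Transport of a cohomology system `J ↦ H¹(H|_J, A)` on `Π` to an isomorphic topological group
`Π' ≅ Π`: the module at `J' ≤ Π'` is the module at its image in `Π` (functoriality of Prop. 1.4's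
"functorial group-theoretic algorithm"). [claim: Mochizuki2012, status: disputed] (IUTchII §1 Prop 1.4, kurims p.27) -/
def comap (X : CohomologySystem P) (e : P' ≃ₜ* P) : CohomologySystem P' where
  H1 J := X.H1 (J.map e.toMulEquiv.toMonoidHom)
  res h := X.res (Subgroup.map_mono h)
  lim := X.lim
  toLim J := X.toLim (J.map e.toMulEquiv.toMonoidHom)
  toLim_res h x := X.toLim_res (Subgroup.map_mono h) x

/-- The transported system has the same direct limit. [claim: Mochizuki2012, status: disputed] (IUTchII §1 Prop 1.4, kurims p.27) -/
theorem comap_lim (X : CohomologySystem P) (e : P' ≃ₜ* P) : (X.comap e).lim = X.lim := rfl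

end CohomologySystem

namespace EtaleThetaData

variable {S : ThetaSetting.{u}} {P P' : TopGroup.{u}}

/-- The interface FORCES the reference subgroup `Π^tp_{Ÿ̲_k} ⊆ Π^tp_{X̲̲_k}` to be stable under every
automorphism of the topological group `Π^tp_{X̲̲_k}` (apply `PiYdd_corresponds` to `e` and to `e ≫ γ`): the
[EtTh] Cor. 2.18 (i) input used in Part B is NECESSARY for the Prop. 1.4 output to exist at all.
[claim: Mochizuki2012, status: disputed] (IUTchII §1 Prop 1.4, kurims p.27) -/
theorem map_piYddRef_eq (X : EtaleThetaData S P) (γ : S.PiX ≃ₜ* S.PiX) :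
    X.PiYddRef.map γ.toMulEquiv.toMonoidHom = X.PiYddRef := by
  obtain ⟨e⟩ := X.isoRef
  conv_lhs => rw [← X.PiYdd_corresponds e]
  rw [← X.PiYdd_corresponds (e.trans γ), Subgroup.map_map]
  rfl

/-- **Functoriality of Prop. 1.4** ("functorial group-theoretic algorithms `Π ↦ Π_Ÿ(Π); (l·Δ_Θ)(Π); θ(Π)`"):
transport of the whole output along an isomorphism of topological groups `e : Π' ≅ Π` — `Π_Ÿ(Π') := e⁻¹(Π_Ÿ(Π))`,
`(l·Δ_Θ)(Π') := e⁻¹((l·Δ_Θ)(Π))`, the cohomology system and the orbit pulled back, `θ(Π')` by `theta_eq`.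
[claim: Mochizuki2012, status: disputed] (IUTchII §1 Prop 1.4, kurims p.27) -/
def comap (X : EtaleThetaData S P) (e : P' ≃ₜ* P) : EtaleThetaData S P' where
  isoRef := ⟨e.trans X.isoRef.some⟩
  PiYddRef := X.PiYddRef
  PiYdd := X.PiYdd.comap e.toMulEquiv.toMonoidHom
  isOpen_PiYdd := by
    rw [Subgroup.coe_comap]
    exact X.isOpen_PiYdd.preimage (map_continuous e)
  PiYdd_corresponds e' := by
    rw [← X.PiYdd_corresponds (e.symm.trans e'), Subgroup.comap_equiv_eq_map_symm', Subgroup.map_map]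
    rfl
  lDeltaTheta := X.lDeltaTheta.map e.symm.toMulEquiv
  coh := X.coh.comap e
  orbit := X.coh.res (le_top : (⊤ : Subgroup P').map e.toMulEquiv.toMonoidHom ≤ ⊤) '' X.orbit
  orbit_nonempty := X.orbit_nonempty.image _
  theta := {b : X.coh.H1 ((⊤ : Subgroup P').map e.toMulEquiv.toMonoidHom) |
    ∃ o ∈ X.coh.res (le_top : (⊤ : Subgroup P').map e.toMulEquiv.toMonoidHom ≤ ⊤) '' X.orbit,
      (S.l : ℕ) • (b + o) = 0}
  theta_eq := rfl

/-- The transported output keeps the reference subgroup. [claim: Mochizuki2012, status: disputed] (IUTchII §1 Prop 1.4, kurims p.27) -/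
@[simp] theorem comap_PiYddRef (X : EtaleThetaData S P) (e : P' ≃ₜ* P) :
    (X.comap e).PiYddRef = X.PiYddRef := rfl

/-- The transported `Π_Ÿ(Π')` is the preimage of `Π_Ÿ(Π)`. [claim: Mochizuki2012, status: disputed] (IUTchII §1 Prop 1.4, kurims p.27) -/
theorem comap_PiYdd (X : EtaleThetaData S P) (e : P' ≃ₜ* P) :
    (X.comap e).PiYdd = X.PiYdd.comap e.toMulEquiv.toMonoidHom := rfl

/-- The transported orbit is the image of the orbit under the system's restriction to the image of `⊤`.
[claim: Mochizuki2012, status: disputed] (IUTchII §1 Prop 1.4, kurims p.27) -/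
theorem comap_orbit (X : EtaleThetaData S P) (e : P' ≃ₜ* P) :
    (X.comap e).orbit =
      X.coh.res (le_top : (⊤ : Subgroup P').map e.toMulEquiv.toMonoidHom ≤ ⊤) '' X.orbit := rfl

end EtaleThetaData

/-! ## Part B. The output for the genuine group `Π^tp_{X̲̲}` of an [EtTh] theta setting -/

namespace EtaleThetaDataOfEtTh

variable {p : ℕ} [Fact p.Prime] {D : Literature.AnabelianGeometry.EtaleTheta.ThetaSetting p}
  {E : D.EtaleThetaData} {l : ℕ} (C : E.DoubleUnderline l)

/-! ### The objects: `Π^tp_{X̲̲} → (Π^tp_X)^Θ`, `Π^tp_{Ÿ̲̲}`, `l·Δ_Θ` -/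

/-- The theta quotient restricted to `Π^tp_{X̲̲} ⊆ Π^tp_X` — through it `Π^tp_{X̲̲}` acts on `Δ_Θ ⊇ l·Δ_Θ` by
conjugation. [cite: MochizukiEtTh2009, Prop 2.12 (i) p.45] -/
abbrev toThetaUU : C.Huu →* D.GtpTheta := D.toTheta.comp C.Huu.subtype

/-- **`Π_Ÿ(Π)` for `Π = Π^tp_{X̲̲}`**: `Π^tp_{Ÿ̲̲} = Π^tp_Ÿ ∩ Π^tp_{X̲̲}` as a subgroup of `Π^tp_{X̲̲}` ("the open subgroup
corresponding to the tempered covering `Ÿ̲`"; = L2-t8's `thetaEnvData.PiYdd`).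
[claim: Mochizuki2012, status: disputed] (IUTchII §1 Prop 1.4, kurims p.27) -/
abbrev piYddUU : Subgroup C.Huu := D.GtpYdd.subgroupOf C.Huu

/-- `Π^tp_{Ÿ̲̲} ⊆ Π^tp_{X̲̲}` is open (under "`K = K̈`"). [cite: MochizukiEtTh2009, Def 2.7 p.41] -/
theorem isOpen_piYddUU (hS : D.Sec2Hyps) : IsOpen (piYddUU C : Set C.Huu) := by
  rw [Subgroup.coe_subgroupOf]
  exact (Literature.AnabelianGeometry.EtaleTheta.ThetaSetting.EtaleThetaData.DoubleUnderline.isOpen_GtpYdd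
    hS).preimage continuous_subtype_val

/-- `Π^tp_{Ÿ̲̲}` is normal in `Π^tp_{X̲̲}` ("`Π^tp_{X̲̲}/Π^tp_{Ÿ̲̲} ≅ (l·ℤ) × μ_2`", [EtTh] p. 41).
[cite: MochizukiEtTh2009, Def 2.7 p.41] -/
theorem piYddUU_normal (hC : D.Compat) : (piYddUU C).Normal :=
  hC.GtpYdd_normal.subgroupOf C.Huu

/-- `l·Δ_Θ (≅ Ẑ(1))` is commutative (a subgroup of the commutative `Δ_Θ`).
[cite: MochizukiEtTh2009, Prop 2.12 (i) p.45] -/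
theorem lDeltaTheta_isMulCommutative : IsMulCommutative (D.lDeltaTheta l) :=
  ⟨⟨fun a b => Subtype.ext (D.ker_thetaToEll_comm a.1 (D.lDeltaTheta_le l a.2) b.1
    (D.lDeltaTheta_le l b.2))⟩⟩

/-- **`(l·Δ_Θ)(Π)` for `Π = Π^tp_{X̲̲}`** as a subquotient of `Π`: the inverse image of `l·Δ_Θ ⊆ (Π^tp_X)^Θ` modulo
`Ker(Π^tp_{X̲̲} → (Π^tp_X)^Θ)` (= L2-t8's `rigidData.lDeltaTheta ⧸ rigidData.thetaKer`; [EtTh] Prop. 2.12 (i)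
"`Ker(Δ^Θ_* ↠ Δ^ell_*) = l·Δ_Θ`"). [claim: Mochizuki2012, status: disputed] (IUTchII §1 Prop 1.4, kurims p.27) -/
def lDeltaThetaUU : Subquotient C.Huu where
  top := (D.lDeltaTheta l).comap (toThetaUU C)
  bot := (toThetaUU C).ker
  le x hx := by
    rw [MonoidHom.mem_ker] at hx
    rw [Subgroup.mem_comap, hx]
    exact one_mem _
  normal := ((MonoidHom.normal_ker (toThetaUU C)).subgroupOf _)

/-- The theta quotient identifies the subquotient `(l·Δ_Θ)(Π)` with `l·Δ_Θ`: it induces an INJECTIVE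
homomorphism `top ⧸ bot → l·Δ_Θ` … [cite: MochizukiEtTh2009, Prop 2.12 (i) p.45] -/
def lDeltaThetaUUToLDelta : (lDeltaThetaUU C).carrier →* D.lDeltaTheta l :=
  QuotientGroup.lift _ (((toThetaUU C).comp (lDeltaThetaUU C).top.subtype).codRestrict _ fun x => x.2)
    (by
      intro x hx
      rw [Subgroup.mem_subgroupOf] at hx
      apply Subtype.ext
      exact hx)

/-- … which is injective … [cite: MochizukiEtTh2009, Prop 2.12 (i) p.45] -/
theorem lDeltaThetaUUToLDelta_injective : Function.Injective (lDeltaThetaUUToLDelta C) := by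
  rw [injective_iff_map_eq_one]
  intro x hx
  induction x using QuotientGroup.induction_on with
  | H y =>
    rw [QuotientGroup.eq_one_iff, Subgroup.mem_subgroupOf]
    change (y : C.Huu) ∈ (toThetaUU C).ker
    rw [MonoidHom.mem_ker]
    exact congrArg Subtype.val hx

/-- … and surjective ("`Δ_{X̲̲}` maps isomorphically onto `Δ̄^ell_X`", [EtTh] Prop. 2.2 (ii): the theta quotient of
`Π^tp_{X̲̲}` meets `Δ_Θ` in `l·Δ_Θ`, field `map_toTheta_Huu`). [cite: MochizukiEtTh2009, Prop 2.2 (ii) p.37] -/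
theorem lDeltaThetaUUToLDelta_surjective : Function.Surjective (lDeltaThetaUUToLDelta C) := by
  intro a
  have ha : (a : D.GtpTheta) ∈ C.Huu.map D.toTheta ⊓ D.DeltaTheta := by
    rw [C.map_toTheta_Huu]; exact a.2
  obtain ⟨⟨h, hh, hha⟩, -⟩ := ha
  have hmem : (⟨h, hh⟩ : C.Huu) ∈ (lDeltaThetaUU C).top := by
    change (⟨h, hh⟩ : C.Huu) ∈ (D.lDeltaTheta l).comap (toThetaUU C)
    rw [Subgroup.mem_comap, MonoidHom.coe_comp, Function.comp_apply, Subgroup.coe_subtype, hha]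
    exact a.2
  refine ⟨QuotientGroup.mk ⟨⟨h, hh⟩, hmem⟩, Subtype.ext ?_⟩
  simpa [lDeltaThetaUUToLDelta] using hha

/-! ### The cohomology system `J ↦ H¹(Π^tp_{Ÿ̲̲}|_J, l·Δ_Θ)` (abc-iut-L6-t1's bridge, instantiated) -/

/-- **`J ↦ H¹(Π_Ÿ(Π)|_J, (l·Δ_Θ)(Π))` for `Π = Π^tp_{X̲̲}`**: L6-t1's `cohomologySystemOfContH1` on the genuine continuous
cohomology `ContH1` of abc-iut-L2-t1, `Π^tp_{X̲̲}` acting on `l·Δ_Θ ⊆ (Π^tp_X)^Θ` by conjugation through the theta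
quotient. [claim: Mochizuki2012, status: disputed] (IUTchII §1 Prop 1.4, kurims p.27) -/
def cohUU [IsMulCommutative (D.lDeltaTheta l)] : CohomologySystem (TopGroup.of C.Huu) :=
  cohomologySystemOfContH1 (P := TopGroup.of C.Huu) (toThetaUU C) (D.lDeltaTheta l) (piYddUU C)

/-- At `J = ⊤`: `H1 ⊤ ≅ H¹(Π^tp_{Ÿ̲̲} ∩ ⊤, l·Δ_Θ)` (L6-t1's comparison at the finite-index open subgroup `⊤`).
[claim: Mochizuki2012, status: disputed] (IUTchII §1 Prop 1.4, kurims p.27) -/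
def h1TopEquiv [IsMulCommutative (D.lDeltaTheta l)] :
    (cohUU C).H1 ⊤ ≃+ Additive (ContH1 (toThetaUU C) (D.lDeltaTheta l) (piYddUU C ⊓ ⊤)) :=
  h1EquivOfFiniteIndexOpen (P := TopGroup.of C.Huu) (toThetaUU C) (D.lDeltaTheta l) (piYddUU C) ⊤
    inferInstance isOpen_univ

/-! ### The class `η̲̈^Θ ∈ H¹(Π^tp_{Ÿ̲̲}, l·Δ_Θ)` of an `l`-th root of the étale theta class and its orbit -/

/-- **Lifting a `Δ_Θ`-valued cocycle with values in `l·Δ_Θ`** on `Π^tp_{Ÿ̲̲} = Π^tp_Ÿ ∩ Π^tp_{X̲̲} ⊆ Π^tp_X` to an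
`l·Δ_Θ`-valued cocycle on the copy `Π^tp_{Ÿ̲̲} ⊆ Π^tp_{X̲̲}` ([EtTh] p. 41: "upon restriction to the covering
`Ÿ̲̲ → Ÿ` … the class `η̈^Θ` determines a class `η̲̈^Θ ∈ H¹(Π^tp_Ÿ̲̲, l·Δ_Θ)`").
[cite: MochizukiEtTh2009, Def 2.7 p.41] -/
def liftCocycle [IsMulCommutative (D.lDeltaTheta l)] (f : C.GtpYdduu → D.DeltaTheta)
    (hf : f ∈ contCocycles D.toTheta D.DeltaTheta C.GtpYdduu)
    (hval : ∀ g, (f g : D.GtpTheta) ∈ D.lDeltaTheta l) :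
    contCocycles (toThetaUU C) (D.lDeltaTheta l) (piYddUU C) :=
  ⟨fun g => ⟨(f (C.inclYdduu g) : D.GtpTheta), hval _⟩, by
    refine ⟨?_, fun g h => ?_⟩
    · exact Continuous.subtype_mk
        (continuous_subtype_val.comp (hf.1.comp C.continuous_inclYdduu)) _
    · apply Subtype.ext
      have e2 := congrArg (fun x : D.DeltaTheta => (x : D.GtpTheta)) (hf.2 (C.inclYdduu g) (C.inclYdduu h))
      simp only [Subgroup.coe_mul, MulAut.conjNormal_apply] at e2
      rw [Subgroup.coe_mul, MulAut.conjNormal_apply]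
      exact e2⟩

/-- The lift has the prescribed values. [cite: MochizukiEtTh2009, Def 2.7 p.41] -/
@[simp] theorem coe_liftCocycle_apply [IsMulCommutative (D.lDeltaTheta l)] (f : C.GtpYdduu → D.DeltaTheta)
    (hf : f ∈ contCocycles D.toTheta D.DeltaTheta C.GtpYdduu) (hval : ∀ g, (f g : D.GtpTheta) ∈ D.lDeltaTheta l)
    (g : piYddUU C) : ((liftCocycle C f hf hval).1 g : D.GtpTheta) = f (C.inclYdduu g) := rfl

/-- **The cocycle of an `l`-th root of the étale theta class**: the `l·Δ_Θ`-valued lift of the distinguished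
representative of `η̈^Θ|_{Π^tp_{Ÿ̲̲}}` supplied by the choice `X̲̲` (field `DoubleUnderline.eta_res`).
[cite: MochizukiEtTh2009, Def 2.7 p.41] -/
def rootCocycle [IsMulCommutative (D.lDeltaTheta l)] : contCocycles (toThetaUU C) (D.lDeltaTheta l) (piYddUU C) :=
  liftCocycle C C.eta_res.choose C.eta_res.choose_spec.choose C.eta_res.choose_spec.choose_spec.1

/-- The underlying `Δ_Θ`-valued cocycle of `rootCocycle` represents `η̈^Θ|_{Π^tp_{Ÿ̲̲}}` ([EtTh] p. 41).
[cite: MochizukiEtTh2009, Def 2.7 p.41] -/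
theorem mk_rootCocycle_base :
    ContH1.mk C.eta_res.choose C.eta_res.choose_spec.choose =
      ContH1.res D.toTheta D.DeltaTheta inf_le_left E.etaDd :=
  C.eta_res.choose_spec.choose_spec.2

/-- **`η̲̈^Θ ∈ H¹(Π^tp_{Ÿ̲̲}, l·Δ_Θ)`**, the class of [the Kummer class of] an `l`-th root of the étale theta function
([EtTh] p. 41; [IUTchII] Prop. 1.4 "an `l`-th root of the étale theta function"). Determined by the choices up
to a root of unity of order `l` ([EtTh] Cor. 2.8 (i)). [cite: MochizukiEtTh2009, Def 2.7 p.41] -/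
def etaRoot [IsMulCommutative (D.lDeltaTheta l)] :
    ContH1 (toThetaUU C) (D.lDeltaTheta l) (piYddUU C) :=
  ContH1.mk (rootCocycle C).1 (rootCocycle C).2

/-- **The `(l·ℤ × μ_2)`-orbit `η̲̈^{Θ,l·ℤ×μ_2}`** of `η̲̈^Θ` in `H¹(Π^tp_{Ÿ̲̲}, l·Δ_Θ)`: the conjugates by
`Π^tp_{X̲̲} ↠ Π^tp_{X̲̲}/Π^tp_{Ÿ̲̲} ≅ (l·ℤ) × μ_2` ([EtTh] p. 41; [IUTchII] Prop. 1.4 "the `(l·ℤ × μ_2)`-orbit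
`η̈^{Θ,l·ℤ×μ_2}` of an `l`-th root"). [cite: MochizukiEtTh2009, Def 2.7 p.41] -/
def etaRootOrbit [IsMulCommutative (D.lDeltaTheta l)] (hC : D.Compat) :
    Set (ContH1 (toThetaUU C) (D.lDeltaTheta l) (piYddUU C)) :=
  haveI := piYddUU_normal C hC
  {x | ∃ σ : C.Huu, x = ContH1.conj (toThetaUU C) (D.lDeltaTheta l) σ (etaRoot C)}

/-- `η̲̈^Θ` lies in its orbit (conjugation by `1`). [cite: MochizukiEtTh2009, Def 2.7 p.41] -/
theorem etaRoot_mem_etaRootOrbit [IsMulCommutative (D.lDeltaTheta l)] (hC : D.Compat) :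
    etaRoot C ∈ etaRootOrbit C hC := by
  haveI := piYddUU_normal C hC
  refine ⟨1, ?_⟩
  rw [Literature.AnabelianGeometry.EtaleTheta.ThetaSetting.EtaleThetaData.DoubleUnderline.contH1_conj_one]

/-- The orbit is nonempty. [cite: MochizukiEtTh2009, Def 2.7 p.41] -/
theorem etaRootOrbit_nonempty [IsMulCommutative (D.lDeltaTheta l)] (hC : D.Compat) :
    (etaRootOrbit C hC).Nonempty :=
  ⟨_, etaRoot_mem_etaRootOrbit C hC⟩

/-- The orbit read in the cohomology system at `J = ⊤` (restriction to `Π^tp_{Ÿ̲̲} ∩ ⊤`, then L6-t1's comparison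
`H1 ⊤ ≅ H¹(Π^tp_{Ÿ̲̲} ∩ ⊤, l·Δ_Θ)`): the datum `orbit` of the interface.
[claim: Mochizuki2012, status: disputed] (IUTchII §1 Prop 1.4, kurims p.27) -/
def orbitH1 [IsMulCommutative (D.lDeltaTheta l)] (hC : D.Compat) : Set ((cohUU C).H1 ⊤) :=
  (fun x => (h1TopEquiv C).symm (Additive.ofMul
    (ContH1.res (toThetaUU C) (D.lDeltaTheta l) (inf_le_left : piYddUU C ⊓ ⊤ ≤ piYddUU C) x))) ''
    etaRootOrbit C hC

/-- The datum `orbit` is nonempty. [claim: Mochizuki2012, status: disputed] (IUTchII §1 Prop 1.4, kurims p.27) -/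
theorem orbitH1_nonempty [IsMulCommutative (D.lDeltaTheta l)] (hC : D.Compat) : (orbitH1 C hC).Nonempty :=
  (etaRootOrbit_nonempty C hC).image _

/-! ### The Prop. 1.4 output for `Π = Π^tp_{X̲̲}` and for every `Π ≅ Π^tp_{X̲̲}` -/

variable {N : ℕ+} (μ : D.CyclotomeMod l N) (hC : D.Compat) (hS : D.Sec2Hyps)
  (hl : l.Prime) (hp2 : p ≠ 2) (hpl : p ≠ l) (hζ : ∃ ζ : D.K, IsPrimitiveRoot ζ (4 * l))
  {η : (C.thetaEnvData μ hC hS).PiYdd → MuN p N} (hη : η ∈ (C.thetaEnvData μ hC hS).thetaCocycles)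

/-- **[IUTchII] Prop. 1.4 for the genuine group `Π = Π^tp_{X̲̲_k}`** of the [IUTchII] §1 setting
`ThetaSetting.ofDoubleUnderline` determined by an [EtTh] theta setting: the OUTPUT structure `EtaleThetaData`
INHABITED by `Π_Ÿ(Π) := Π^tp_{Ÿ̲̲}`, `(l·Δ_Θ)(Π) :=` (inverse image of `l·Δ_Θ`) ⧸ `Ker(→ (Π^tp_X)^Θ)`, the genuine
cohomology system `J ↦ H¹(Π^tp_{Ÿ̲̲}|_J, l·Δ_Θ)`, the orbit `η̲̈^{Θ,l·ℤ×μ_2}` and `θ(Π) :=` its `μ_l`-saturated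
reciprocal. The clause "corresponding to the tempered covering `Ÿ̲`" is the hypothesis `hchar` = the `Π^tp_Ÿ`
clause of [EtTh] Cor. 2.18 (i) (`RigidData.Cor218_i`, by name): `Π^tp_{Ÿ̲̲}` is stable under every automorphism
of the topological group `Π^tp_{X̲̲}`. [claim: Mochizuki2012, status: disputed] (IUTchII §1 Prop 1.4, kurims p.27) -/
def etaleThetaDataRef
    (hchar : ∀ γ : C.Huu ≃ₜ* C.Huu, (piYddUU C).map γ.toMulEquiv.toMonoidHom = piYddUU C) :
    EtaleThetaData (ThetaSetting.ofDoubleUnderline C μ hC hS hl hp2 hpl hζ hη)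
      (ThetaSetting.ofDoubleUnderline C μ hC hS hl hp2 hpl hζ hη).PiX :=
  haveI := lDeltaTheta_isMulCommutative (D := D) (l := l)
  { isoRef := ⟨ContinuousMulEquiv.refl _⟩
    PiYddRef := piYddUU C
    PiYdd := piYddUU C
    isOpen_PiYdd := isOpen_piYddUU C hS
    PiYdd_corresponds := hchar
    lDeltaTheta := lDeltaThetaUU C
    coh := cohUU C
    orbit := orbitH1 C hC
    orbit_nonempty := orbitH1_nonempty C hC
    theta := {b : (cohUU C).H1 ⊤ | ∃ o ∈ orbitH1 C hC, (l : ℕ) • (b + o) = 0}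
    theta_eq := rfl }

/-- **[IUTchII] Prop. 1.4 for every `Π ≅ Π^tp_{X̲̲_k}`** ("`Π` a topological group isomorphic to `Π^tp_{X̲̲_k}`"):
the output for `Π^tp_{X̲̲_k}` transported along the given isomorphism (functoriality, Part A).
[claim: Mochizuki2012, status: disputed] (IUTchII §1 Prop 1.4, kurims p.27) -/
def etaleThetaDataOf {P : TopGroup.{0}}
    (hchar : ∀ γ : C.Huu ≃ₜ* C.Huu, (piYddUU C).map γ.toMulEquiv.toMonoidHom = piYddUU C)
    (e : P ≃ₜ* (ThetaSetting.ofDoubleUnderline C μ hC hS hl hp2 hpl hζ hη).PiX) :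
    EtaleThetaData (ThetaSetting.ofDoubleUnderline C μ hC hS hl hp2 hpl hζ hη) P :=
  (etaleThetaDataRef C μ hC hS hl hp2 hpl hζ hη hchar).comap e

/-- The reference output's `Π_Ÿ(Π)` IS L2-t8's `thetaEnvData.PiYdd` (definitional bookkeeping).
[cite: MochizukiEtTh2009, Def 2.13 p.47] -/
theorem etaleThetaDataRef_PiYdd
    (hchar : ∀ γ : C.Huu ≃ₜ* C.Huu, (piYddUU C).map γ.toMulEquiv.toMonoidHom = piYddUU C) :
    (etaleThetaDataRef C μ hC hS hl hp2 hpl hζ hη hchar).PiYdd = (C.thetaEnvData μ hC hS).PiYdd := rfl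

/-- `θ(Π)` of the reference output is nonempty (it contains `-η̲̈^Θ`). [claim: Mochizuki2012, status: disputed] (IUTchII §1 Prop 1.4, kurims p.27) -/
theorem etaleThetaDataRef_theta_nonempty
    (hchar : ∀ γ : C.Huu ≃ₜ* C.Huu, (piYddUU C).map γ.toMulEquiv.toMonoidHom = piYddUU C) :
    (etaleThetaDataRef C μ hC hS hl hp2 hpl hζ hη hchar).theta.Nonempty :=
  (etaleThetaDataRef C μ hC hS hl hp2 hpl hζ hη hchar).theta_nonempty

/-! ### The hypothesis `hchar` IS the `Π^tp_Ÿ` clause of [EtTh] Cor. 2.18 (i) (L2's named fact, by name) -/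

/-- The characteristic property of `Π^tp_{Ÿ̲̲} ⊆ Π^tp_{X̲̲}` used above is (the second conjunct of) abc-iut-L2-t2's named
fact `RigidData.Cor218_i` ([EtTh] Cor. 2.18 (i): "the subquotients `Π^tp_Y`, `Π^tp_Ÿ`, … may be reconstructed via a
functorial group-theoretic algorithm") for L2-t8's instantiated rigidity data `C.rigidData` of `X̲̲` — whatever cusp
labels `L` are supplied. [cite: MochizukiEtTh2009, Cor 2.18(i) p.60] -/
theorem hchar_of_cor218_i (h15 : D.Prop15iii E hC) (L : C.CuspLabels)
    (h218 : (C.rigidData μ hC hS h15 L).Cor218_i) :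
    ∀ γ : C.Huu ≃ₜ* C.Huu, (piYddUU C).map γ.toMulEquiv.toMonoidHom = piYddUU C :=
  fun γ => (h218 γ).2.1

/-- **[IUTchII] Prop. 1.4 for `Π^tp_{X̲̲_k}`, modulo [EtTh] Cor. 2.18 (i) by name** (and [EtTh] Prop. 1.5 (iii), the
named fact L2-t8's `rigidData` is conditional on): the output structure inhabited.
[claim: Mochizuki2012, status: disputed] (IUTchII §1 Prop 1.4, kurims p.27) -/
def etaleThetaDataRefOfCor218 (h15 : D.Prop15iii E hC) (L : C.CuspLabels)
    (h218 : (C.rigidData μ hC hS h15 L).Cor218_i) :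
    EtaleThetaData (ThetaSetting.ofDoubleUnderline C μ hC hS hl hp2 hpl hζ hη)
      (ThetaSetting.ofDoubleUnderline C μ hC hS hl hp2 hpl hζ hη).PiX :=
  etaleThetaDataRef C μ hC hS hl hp2 hpl hζ hη (hchar_of_cor218_i C μ hC hS h15 L h218)

/-- … and for every `Π ≅ Π^tp_{X̲̲_k}`. [claim: Mochizuki2012, status: disputed] (IUTchII §1 Prop 1.4, kurims p.27) -/
def etaleThetaDataOfCor218 {P : TopGroup.{0}} (h15 : D.Prop15iii E hC) (L : C.CuspLabels)
    (h218 : (C.rigidData μ hC hS h15 L).Cor218_i)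
    (e : P ≃ₜ* (ThetaSetting.ofDoubleUnderline C μ hC hS hl hp2 hpl hζ hη).PiX) :
    EtaleThetaData (ThetaSetting.ofDoubleUnderline C μ hC hS hl hp2 hpl hζ hη) P :=
  (etaleThetaDataRefOfCor218 C μ hC hS hl hp2 hpl hζ hη h15 L h218).comap e

end EtaleThetaDataOfEtTh

end Literature.IUT.HodgeArakelov

end
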